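import Summits.ResolutionOfSingularities.ResolutionOfSingularities.Theorems.FrobeniusLadderFInjectiveMacaulayficationFilteredReesDomain
import Summits.ResolutionOfSingularities.ResolutionOfSingularities.Theorems.FrobeniusLadderFInjectiveMacaulayficationConeFibreClause
import HarnessLib

/-!
# (F4c) THE `hclB` INPUT OF THE FILTERED ENGINE: the clause of `T′♮` at every maximal ideal containing `s̄`
# (crux `FInjectiveMacaulayfication`, line `graded-engine` §17 filtered engine G4♮ — CRUX-PLAN v6 §1.2 pieces (F4)+(F5) packaged)

Support file for crux stmt-ResolutionOfSingularities-15315 (`FrobeniusLadder.FInjectiveMacaulayfication`), chain w45a,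
seat res-L1-w45a-stub-3. [OURS · L1 W4.5a] — NOT a statement of the manuscript; AI-written, weaker than expert review.

`GradedChartClauseAssembly.chartClause_core_affine` (p483269) with `B := T′♮ = ℛ[1/x̄_v^c]`, `b := s̄/1` asks for
`hclB : ∀ P maximal, b ∈ P → clause(B_P)` — ONLY maximal ideals containing `b` (so no `hoff`-transport off `V(s)` is needed inside
G4♮; `hoff` itself is consumed by the core `WeightedConeCore` at the level of G5♮). This file assembles that `hclB` from the landed
pieces: the instances of (F4b) `FilteredReesDomain` (`T′♮` a Noetherian domain of characteristic `p`, `s̄/1 ≠ 0`), the fibre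
presentation (F4a) `FilteredReesFibre.exists_fibreMap` (`π♮ : T′♮ ↠ (k[X]/(f₀))[1/x̄_v^c]`, `ker π♮ = (s̄/1)`), and H-G4a♮
`ConeFibreClause.coneFibreClause` (p482990: E1 `OnExceptionalDeform` along `π♮` + the clause of the cone chart from `hoff₀`):

* `filteredRees_hclB` — **for every maximal `P ∋ s̄/1` of `T′♮`: `T′♮_P` is a domain and every system of parameters of `T′♮_P` is weakly
  regular and generates a Frobenius-closed ideal**, from `hoff₀` (the clause of `k[X]/(f₀)` at maximal ideals missing some `x̄ⱼ`) alone;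
* `filteredRees_hclB'` — the same with the `IsDomain` conjunct dropped, i.e. LITERALLY the `hclB` binder of `chartClause_core_affine`.

No definitions, no named facts; glue only. [folklore]
-/

-- single-problem summit: the doubled namespace component is forced
set_option linter.dupNamespace false

noncomputable section

namespace Summit.ResolutionOfSingularities.ResolutionOfSingularities.Theorems.FInjectiveMacaulayfication.FilteredReesConeClause

open Summit.ResolutionOfSingularities.ResolutionOfSingularities.Theorems.FInjectiveMacaulayfication

variable {k : Type} [Field k] {n : ℕ}

/-- **(F4c) The clause of `T′♮ = k[X,s]/(f^h)[1/x̄_v^c]` at every maximal ideal containing `s̄`, from `hoff₀`.** [folklore] -/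
theorem filteredRees_hclB (p : ℕ) [Fact p.Prime] (k : Type) [Field k] [CharP k p] (n : ℕ) (w : Fin n → ℕ) (D : ℕ)
    (f : MvPolynomial (Fin n) k) (fh : MvPolynomial (Option (Fin n)) k)
    (hfh : fh = ∑ b ∈ f.support, MvPolynomial.monomial
      (Finsupp.mapDomain some b + Finsupp.single none (Finsupp.weight w b - D)) (MvPolynomial.coeff b f))
    (hD0 : ∀ m < D, MvPolynomial.weightedHomogeneousComponent w m f = 0)
    (f₀ : MvPolynomial (Fin n) k) (hf₀ : f₀ = MvPolynomial.weightedHomogeneousComponent w D f) (hD : f₀ ≠ 0)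
    (hfprime : (Ideal.span {f}).IsPrime) (hXne : ∀ j : Fin n, Ideal.Quotient.mk (Ideal.span {f}) (MvPolynomial.X j) ≠ 0)
    (v : Fin n) (c : ℕ) (hc : 0 < c)
    (hoff₀ : ∀ (Q : Ideal (MvPolynomial (Fin n) k ⧸ Ideal.span {f₀})) [Q.IsMaximal],
      (∃ j : Fin n, Ideal.Quotient.mk (Ideal.span {f₀}) (MvPolynomial.X j) ∉ Q) →
      ∀ d : ℕ, ringKrullDim (Localization.AtPrime Q) = d → ∀ t : Fin d → Localization.AtPrime Q,
        (Ideal.span (Set.range t)).radical.IsMaximal →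
          RingTheory.Sequence.IsWeaklyRegular (Localization.AtPrime Q) (List.ofFn t) ∧
          ∀ y : Localization.AtPrime Q, (∃ e : ℕ, y ^ p ^ e ∈ Ideal.span
            ((fun z : Localization.AtPrime Q => z ^ p ^ e) ''
              (Ideal.span (Set.range t) : Set (Localization.AtPrime Q)))) → y ∈ Ideal.span (Set.range t))
    (P : Ideal (Localization.Away (Ideal.Quotient.mk (Ideal.span {fh}) (MvPolynomial.X (some v)) ^ c))) [P.IsMaximal]
    (hsP : algebraMap (MvPolynomial (Option (Fin n)) k ⧸ Ideal.span {fh}) (Localization.Away (Ideal.Quotient.mk (Ideal.span {fh}) (MvPolynomial.X (some v)) ^ c)) (Ideal.Quotient.mk (Ideal.span {fh}) (MvPolynomial.X none)) ∈ P) :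
    IsDomain (Localization.AtPrime P) ∧
      ∀ d : ℕ, ringKrullDim (Localization.AtPrime P) = d → ∀ t : Fin d → Localization.AtPrime P,
        (Ideal.span (Set.range t)).radical.IsMaximal →
          RingTheory.Sequence.IsWeaklyRegular (Localization.AtPrime P) (List.ofFn t) ∧
          ∀ y : Localization.AtPrime P, (∃ e : ℕ, y ^ p ^ e ∈ Ideal.span
            ((fun z : Localization.AtPrime P => z ^ p ^ e) ''
              (Ideal.span (Set.range t) : Set (Localization.AtPrime P)))) → y ∈ Ideal.span (Set.range t) := by
  have hD' : MvPolynomial.weightedHomogeneousComponent w D f ≠ 0 := hf₀ ▸ hD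
  haveI := FilteredReesDomain.isDomain_reesAway w D f fh hfh hD0 hD' hfprime hXne v c
  haveI := FilteredReesDomain.charP_reesAway p w D f fh hfh hD0 hD' hfprime hXne v c
  haveI : IsNoetherianRing (Localization.Away (Ideal.Quotient.mk (Ideal.span {fh}) (MvPolynomial.X (some v)) ^ c)) := Algebra.FiniteType.isNoetherianRing k _
  obtain ⟨π, -, hπ, hker⟩ := FilteredReesFibre.exists_fibreMap w D f fh hfh hD0 f₀ hf₀ v c
  exact ConeFibreClause.coneFibreClause p k n f₀ v c hc hoff₀ (Localization.Away (Ideal.Quotient.mk (Ideal.span {fh}) (MvPolynomial.X (some v)) ^ c)) _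
    (FilteredReesDomain.algebraMap_mk_X_none_ne_zero w D f fh hfh hD0 hD' hfprime hXne v c) π hπ hker P hsP

/-- **(F4c′) LITERALLY the `hclB` binder of `chartClause_core_affine` for `B := T′♮`, `b := s̄/1`.** [folklore] -/
theorem filteredRees_hclB' (p : ℕ) [Fact p.Prime] (k : Type) [Field k] [CharP k p] (n : ℕ) (w : Fin n → ℕ) (D : ℕ)
    (f : MvPolynomial (Fin n) k) (fh : MvPolynomial (Option (Fin n)) k)
    (hfh : fh = ∑ b ∈ f.support, MvPolynomial.monomial
      (Finsupp.mapDomain some b + Finsupp.single none (Finsupp.weight w b - D)) (MvPolynomial.coeff b f))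
    (hD0 : ∀ m < D, MvPolynomial.weightedHomogeneousComponent w m f = 0)
    (f₀ : MvPolynomial (Fin n) k) (hf₀ : f₀ = MvPolynomial.weightedHomogeneousComponent w D f) (hD : f₀ ≠ 0)
    (hfprime : (Ideal.span {f}).IsPrime) (hXne : ∀ j : Fin n, Ideal.Quotient.mk (Ideal.span {f}) (MvPolynomial.X j) ≠ 0)
    (v : Fin n) (c : ℕ) (hc : 0 < c)
    (hoff₀ : ∀ (Q : Ideal (MvPolynomial (Fin n) k ⧸ Ideal.span {f₀})) [Q.IsMaximal],
      (∃ j : Fin n, Ideal.Quotient.mk (Ideal.span {f₀}) (MvPolynomial.X j) ∉ Q) →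
      ∀ d : ℕ, ringKrullDim (Localization.AtPrime Q) = d → ∀ t : Fin d → Localization.AtPrime Q,
        (Ideal.span (Set.range t)).radical.IsMaximal →
          RingTheory.Sequence.IsWeaklyRegular (Localization.AtPrime Q) (List.ofFn t) ∧
          ∀ y : Localization.AtPrime Q, (∃ e : ℕ, y ^ p ^ e ∈ Ideal.span
            ((fun z : Localization.AtPrime Q => z ^ p ^ e) ''
              (Ideal.span (Set.range t) : Set (Localization.AtPrime Q)))) → y ∈ Ideal.span (Set.range t)) :
    ∀ (P : Ideal (Localization.Away (Ideal.Quotient.mk (Ideal.span {fh}) (MvPolynomial.X (some v)) ^ c))) [P.IsMaximal],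
      algebraMap (MvPolynomial (Option (Fin n)) k ⧸ Ideal.span {fh}) (Localization.Away (Ideal.Quotient.mk (Ideal.span {fh}) (MvPolynomial.X (some v)) ^ c)) (Ideal.Quotient.mk (Ideal.span {fh}) (MvPolynomial.X none)) ∈ P →
      ∀ d : ℕ, ringKrullDim (Localization.AtPrime P) = d → ∀ t : Fin d → Localization.AtPrime P,
        (Ideal.span (Set.range t)).radical.IsMaximal →
          RingTheory.Sequence.IsWeaklyRegular (Localization.AtPrime P) (List.ofFn t) ∧
          ∀ y : Localization.AtPrime P, (∃ e : ℕ, y ^ p ^ e ∈ Ideal.span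
            ((fun z : Localization.AtPrime P => z ^ p ^ e) ''
              (Ideal.span (Set.range t) : Set (Localization.AtPrime P)))) → y ∈ Ideal.span (Set.range t) :=
  fun P _ hsP => (filteredRees_hclB p k n w D f fh hfh hD0 f₀ hf₀ hD hfprime hXne v c hc hoff₀ P hsP).2

end Summit.ResolutionOfSingularities.ResolutionOfSingularities.Theorems.FInjectiveMacaulayfication.FilteredReesConeClause

end
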